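import Summits.QuantumFields.YangMills.Theorems.BalabanUVNodesN20KeyedRelWeightLevels

/-!
# BalabanUVNodes ∕ N20 (NE7b) — THE BIRTH-LEVEL SURVIVAL SOCKET ON THE LIVE-SELECTOR LINE: the per-birth-level survival domination read AGAINST THE DRESSED PARTITION
# FUNCTIONS OF RECORD `Z_{K₀+K}(t)`, `Z_{K₀+K+1}(t)` (E1 ∕ E2), and the K3⁷ v5 `KeyedRelWeight` binder shape from per-tuple LEVEL-FRACTION data
# (companion of `Thm/BalabanUVNodesN20KeyedRelWeightLevels`, same seat, same day)

Cell `pub-ymgap` (HUMAN RULING D-0062 Track A; work-bound push D-0149, director-ym №197), width seat `pub-ymgap-dag-n20-w2` (gen 3) on node N20 = NE7b; CLAIM-2 of the re-seat,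
the live-line edition of CLAIM-1 `Thm/BalabanUVNodesN20KeyedRelWeightLevels` (kept under the 400-line rule as a sibling module rather than a v1.1).  Filed `--kind proof --supports
stmt-QuantumFields-20544 --as helper` (K3⁷ `SpineGivenEndpointR13SepCoPH`, skeleton v5 941dddb108cbaacf); COUNT-NEUTRAL; LOCATED.
[III] = [Balaban1988Convergent], [LF-II] = [Balaban1989LargeFieldII], [UV3] = [Balaban1985UV3].

WHY.  CLAIM-1 §4 states the survival domination against the two runs' keyed CLASS TOTALS `Σ_{classSet₁₃} weightA₁₃ K t`, `Σ_{classSet₁₃} weightB₁₃ K t` — hypothesis-free objects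
at every Stage-13 tuple with core provisos.  On the live-selector line (the pin `hsel` with any selector letter `E`, (H-U) `LocalBgMeasurable`, (H-ζ) `ZetaMeasurable`, `0 ≤ ζ` from the
provisos) those totals ARE the tuple's own dressed partition functions `Z_{K₀+K}(t)` and `Z_{K₀+K+1}(t)` (dag-n20-d's E1 ∕ E2 `schemeZ_eq_sum_classSet_weightA` ∕
`schemeZ_succ_eq_sum_classSet_weightB`; gen 2's `…N20KeyedRelWeightFraction` §2 reads the canonical `W` as the worst-source bad fraction of exactly these), so there the hypothesis
takes PRINT's currency verbatim: «the histories whose first large-field region is created at level `j+1` of the `K₀+K`-level run carry at most `V·r^{K₀+K−(j+1)}` of `Z_{K₀+K}(t)`»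
([LF-II] p.384 (1.80) «the factor exp(−κ_j(Z)) controls K renormalization steps», (1.89) p.387).  This module is that reading plus the level-fraction form of CLAIM-1 §5:
* §1 ★★ `W_crOfRecord₁₃VAt_le_survival_of_sel` (live line: survival domination against `Z_{K₀+K}(t)` ∕ `Z_{K₀+K+1}(t)`, cut inside the window ⇒ `W K ≤ V·r^{K₀+K−jcut K}∕(1−r)`) ·
  ★★ `relWeightBound_crOfRecord₁₃VAt_of_survival_of_sel` (+ `V·r^{age floor}∕(1−r) < 1` at every step and `Σ_K V·r^{age floor} < ∞` ⇒ the N20 face AT the reading, canonical `W`);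
* §2 ★★ `keyedRelWeight_shape_crOfRecord₁₃V_of_levelFractions` (the K3⁷ v5 `KeyedRelWeight` binder shape at `crOfRecord₁₃VAt 0 (jc F θ hP g₀ os) sh`, `N = 2`, from per-tuple `∃ a b`
  level-fraction data — the §3 form of CLAIM-1's §5 survival shape);
* §3 `keyB₁₃_mem_stratum_iff` (run B's σ-key in the stratum `j` ⟺ `s'.Λ_{j+2} ≠ T_η ∧ (1 ≤ j → s'.Λ_{j+1} = T_η)` under `0 < θ.τ9.M` — the first large field ONE LEVEL UP, the
  complement of CLAIM-1's run-A form; gen 0's `keyOldLargeField_twoRunKeyB_iff_last`);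
* §4 THE DESIGN RULE: `survivalMajorant_lt_one_of_ageFloor` (`V·r^{a₀} < 1−r` and age floor `≥ a₀` ⇒ the per-step threshold) · ★★ `relWeightBound_crOfRecord₁₃VAt_of_survival_ageFloor`
  (survival rate `r`, entropy `V`, minimal age `a₀` with `V·r^{a₀} < 1−r`, linear age floor ⇒ the N20 face AT the reading — the policy question settled by two numbers).
Cited BY NAME, not re-typed: CLAIM-1 (`W_crOfRecord₁₃VAt_le_survival`, `relWeightBound_crOfRecord₁₃VAt_of_levelFractions`), gen 2 `…Canonical` (`relWeightBound_crOfRecord₁₃VAt_iff`),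
dag-n20-d `…SpineReadingOfRecord13CoPH(V)` (`schemeZ_eq_sum_classSet_weightA`, `schemeZ_succ_eq_sum_classSet_weightB`, `crOfRecord₁₃VAt`), `…SpineCanonicalWeights` (`wInf_nonneg`),
gen 0 `…N21KeyedShellWeightShellZero` (`zeta_nonneg_of_provisos₁₃CoPH`), `…N20TwoRunKeyedPersistentWeight` (`keyOldLargeField_twoRunKeyB_iff_last`), dag-n20-w1
`…N20KeyedRelWeightSocketAtRecord13CoPH` (`keyB₁₃_mem_badClass₁₃_iff`).

HONEST FRAMING.  [folklore] finite-sum ∕ real-analysis bookkeeping; NO weight bounded, NO estimate proved; the survival domination ∕ level fractions are HYPOTHESES — NE7b's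
body in the renewal currency, NAMED OPEN, inhabited for no Bałaban family today (A6: LOCATED; the live-selector pin, (H-U), (H-ζ) displayed).  Nothing of Bałaban's is asserted:
[LF-II] (1.80) ∕ (1.89) print ABSOLUTE size bounds on one run's large-field factors; the relative extraction, the entropy letter `V` and the survival-window bound are the
cell's NE7b — NOT PRINTED for `d = 4`, NOT proved; (α)-instance 0∕1; no `Provisos₁₃CoPH` inhabitant claimed (K0⁷ OPEN); N19 ∕ N20 ∕ N21 ∕ N27 NOT discharged; K3⁷ NOT closed;
counts unmoved (typed 28∕28 · discharged 5∕27); no count claim (the chair's single count line is the only count).  One finite `𝕋⁴_{L^K}` programme at fixed `ε = L^{−K}`, Bałaban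
AS PRINTED; the YM mass gap (Clay) is NOT proved by any of this — R4 closes the conditional finite-𝕋⁴ rung `BalabanLadder.UV` only; NOT ℝ⁴, NOT infinite volume, NOT OS.  No `def`,
no `instance`, no `notation`, no `sorry`.  Sources (locators, bookkeeping only): [UV3] (6) p.257; [LF-II] Thm 1 + (0.1) pp.355–356, (1.80) p.384, (1.89) p.387; [III] (2.18)
p.257; [King1986] (3.10)–(3.11) p.656.
-/

noncomputable section

open scoped BigOperators

namespace Summit.QuantumFields.YangMills.BalabanUVNodes.N20KeyedRelWeightLevelsLive

open Literature.MathematicalPhysics.QuantumFieldTheory.Balaban1983to89 Literature.MathematicalPhysics.QuantumFieldTheory.Balaban1983to89.Node00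
open T4Continuum
open T4WeightBudget (RelWeightBound)
open YMDAG.UVSplit hiding SU
open Summit.QuantumFields.YangMills.BalabanUVNodes.SpineCanonicalWeights
open Summit.QuantumFields.YangMills.BalabanUVNodes.N21KeyedShellWeightShellZero (zeta_nonneg_of_provisos₁₃CoPH)
open Summit.QuantumFields.YangMills.BalabanUVNodes.N20KeyedRelWeightCanonical (relWeightBound_crOfRecord₁₃VAt_iff)
open Summit.QuantumFields.YangMills.BalabanUVNodes.N20KeyedRelWeightLevels (W_crOfRecord₁₃VAt_le_survival relWeightBound_crOfRecord₁₃VAt_of_levelFractions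
  relWeightBound_crOfRecord₁₃VAt_of_survival_linearAge)
open Summit.QuantumFields.YangMills.BalabanUVNodes.N20KeyedRelWeightSocketAtRecord13CoPH (keyB₁₃_mem_badClass₁₃_iff)
open Summit.QuantumFields.YangMills.BalabanUVNodes.N20TwoRunKeyedPersistentWeight (keyOldLargeField_twoRunKeyB_iff_last)

/-! ## §1  On the live-selector line: the survival domination against the dressed partition functions of record -/

section Live

variable {F : T4Family} {N : ℕ} [NeZero N] (θ : Stage13HParams F N) (hP : θ.Provisos₁₃CoPH F N) (K₀ : ℕ) (g₀ : ℕ → ℝ) (os : List (ULoop F))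
  (E : B12.RunParams → ℝ) (hsel : θ.ppSel = ppSelLiveOfRecord F N θ.ν θ.τ9 E (wOfRecord₉ F N θ.toStage9Params)) (hU : LocalBgMeasurable F N θ.ν)
  (hζm : ZetaMeasurable F N θ.ζ) (jcut : ℕ → ℕ) (sh : ShellSplit₁₃CoPH N K₀) [DecidableEq (Σ K, SiteSeqKey F (K₀ + K))]
include hsel hU hζm

/-- **★★ ON THE LIVE LINE, PRINT's CURRENCY VERBATIM**: if at step `K` (cut inside the window) the histories of run A whose FIRST large-field level is `j+1` carry at most
`V·r^{K₀+K−(j+1)} · Z_{K₀+K}(t)` of the tuple's own dressed partition function, and those of run B at most `V·r^{K₀+K−(j+1)} · Z_{K₀+K+1}(t)`, for every `|t| ≤ 1` and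
`j < jcut K` (live-selector pin with any selector letter `E`, (H-U) ∕ (H-ζ); `0 ≤ ζ` from `hP`), then `W K ≤ V·r^{K₀+K−jcut K}∕(1−r)` (§4 through E1 ∕ E2).
[cite: Balaban1985UV3, (6) p.257; Balaban1989LargeFieldII, (1.80) p.384, (1.89) p.387; King1986, (3.10)–(3.11) p.656 (bookkeeping)] -/
theorem W_crOfRecord₁₃VAt_le_survival_of_sel {r V : ℝ} (h0 : 0 ≤ r) (h1 : r < 1) (hV : 0 ≤ V) (K : ℕ) (hwin : jcut K ≤ K₀ + K)
    (hA : ∀ t : ℝ, |t| ≤ 1 → ∀ j < jcut K,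
      ∑ x ∈ badClass₁₃ θ K₀ g₀ (fun _ => j + 1) K t \ badClass₁₃ θ K₀ g₀ (fun _ => j) K t, weightA₁₃ θ hP K₀ g₀ os K t x ≤
        V * r ^ (K₀ + K - (j + 1)) * T4GenFunBounds.schemeZ ((datumOfRecord₁₃CoPH F N θ hP).scheme g₀) os (K₀ + K) t)
    (hB : ∀ t : ℝ, |t| ≤ 1 → ∀ j < jcut K,
      ∑ x ∈ badClass₁₃ θ K₀ g₀ (fun _ => j + 1) K t \ badClass₁₃ θ K₀ g₀ (fun _ => j) K t, weightB₁₃ θ hP K₀ g₀ os K t x ≤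
        V * r ^ (K₀ + K - (j + 1)) * T4GenFunBounds.schemeZ ((datumOfRecord₁₃CoPH F N θ hP).scheme g₀) os (K₀ + K + 1) t) :
    (crOfRecord₁₃VAt K₀ jcut sh F θ hP g₀ os).W K ≤ V * r ^ (K₀ + K - jcut K) / (1 - r) := by
  refine W_crOfRecord₁₃VAt_le_survival θ hP K₀ g₀ os jcut sh h0 h1 hV K hwin (fun t ht j hj => ?_) (fun t ht j hj => ?_)
  · rw [← schemeZ_eq_sum_classSet_weightA K₀ θ hP E hsel hU hζm (zeta_nonneg_of_provisos₁₃CoPH F θ hP) g₀ os K t]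
    exact hA t ht j hj
  · rw [← schemeZ_succ_eq_sum_classSet_weightB K₀ θ hP E hsel hU hζm (zeta_nonneg_of_provisos₁₃CoPH F θ hP) g₀ os K t]
    exact hB t ht j hj

/-- **★★ N20 AT THE READING OF RECORD ON A LIVE TUPLE FROM A PER-BIRTH-LEVEL SURVIVAL RATE AGAINST THE DRESSED PARTITION FUNCTIONS**: the survival domination against
`Z_{K₀+K}(t)` ∕ `Z_{K₀+K+1}(t)` at every step (cut inside the window), `V·r^{age floor}∕(1−r) < 1` at every step, `Σ_K V·r^{age floor} < ∞` ⇒ `RelWeightBound` AT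
`crOfRecord₁₃VAt K₀ jcut sh F θ hP g₀ os` with its canonical `W`.  The domination is NE7b's body in [LF-II] (1.80) ∕ (1.89)'s currency — a HYPOTHESIS, NAMED OPEN.
[cite: Balaban1985UV3, (6) p.257; Balaban1989LargeFieldII, Thm 1 + (0.1) pp.355–356, (1.80) p.384, (1.89) p.387; King1986, (3.10)–(3.11) p.656 (bookkeeping)] -/
theorem relWeightBound_crOfRecord₁₃VAt_of_survival_of_sel {r V : ℝ} (h0 : 0 ≤ r) (h1 : r < 1) (hV : 0 ≤ V) (hwin : ∀ K, jcut K ≤ K₀ + K)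
    (hA : ∀ (K : ℕ) (t : ℝ), |t| ≤ 1 → ∀ j < jcut K,
      ∑ x ∈ badClass₁₃ θ K₀ g₀ (fun _ => j + 1) K t \ badClass₁₃ θ K₀ g₀ (fun _ => j) K t, weightA₁₃ θ hP K₀ g₀ os K t x ≤
        V * r ^ (K₀ + K - (j + 1)) * T4GenFunBounds.schemeZ ((datumOfRecord₁₃CoPH F N θ hP).scheme g₀) os (K₀ + K) t)
    (hB : ∀ (K : ℕ) (t : ℝ), |t| ≤ 1 → ∀ j < jcut K,
      ∑ x ∈ badClass₁₃ θ K₀ g₀ (fun _ => j + 1) K t \ badClass₁₃ θ K₀ g₀ (fun _ => j) K t, weightB₁₃ θ hP K₀ g₀ os K t x ≤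
        V * r ^ (K₀ + K - (j + 1)) * T4GenFunBounds.schemeZ ((datumOfRecord₁₃CoPH F N θ hP).scheme g₀) os (K₀ + K + 1) t)
    (hlt : ∀ K, V * r ^ (K₀ + K - jcut K) / (1 - r) < 1) (hsum : Summable fun K => V * r ^ (K₀ + K - jcut K)) :
    RelWeightBound (crOfRecord₁₃VAt K₀ jcut sh F θ hP g₀ os).l₀ (crOfRecord₁₃VAt K₀ jcut sh F θ hP g₀ os).T (crOfRecord₁₃VAt K₀ jcut sh F θ hP g₀ os).A
      (crOfRecord₁₃VAt K₀ jcut sh F θ hP g₀ os).B (crOfRecord₁₃VAt K₀ jcut sh F θ hP g₀ os).Bad (crOfRecord₁₃VAt K₀ jcut sh F θ hP g₀ os).W := by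
  have hle : ∀ K, (crOfRecord₁₃VAt K₀ jcut sh F θ hP g₀ os).W K ≤ V * r ^ (K₀ + K - jcut K) / (1 - r) := fun K =>
    W_crOfRecord₁₃VAt_le_survival_of_sel θ hP K₀ g₀ os E hsel hU hζm jcut sh h0 h1 hV K (hwin K) (hA K) (hB K)
  exact (relWeightBound_crOfRecord₁₃VAt_iff θ hP K₀ g₀ os jcut sh).2
    ⟨fun K => (hle K).trans_lt (hlt K), Summable.of_nonneg_of_le (fun K => wInf_nonneg K) hle (hsum.div_const (1 - r))⟩

end Live

/-! ## §2  The K3⁷ v5 binder shape from per-tuple level-fraction data -/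

section ShapeLevels

/-- **THE K3⁷ v5 `KeyedRelWeight` BODY AT THE PER-TUPLE-CUT V READING FROM PER-TUPLE LEVEL-FRACTION DATA** (the §3 form of §5: any per-stratum relative bounds `a j K ≥ 0`,
`b j K` with level sums `< 1` and summable, read per tuple). [cite: Balaban1989LargeFieldII, Thm 1 + (0.1) pp.355–356, (1.80) p.384; King1986, (3.10)–(3.11) p.656 (bookkeeping)] -/
theorem keyedRelWeight_shape_crOfRecord₁₃V_of_levelFractions
    (jc : (F : T4Family) → (θ : Stage13HParams F 2) → θ.Provisos₁₃CoPH F 2 → (ℕ → ℝ) → List (ULoop F) → ℕ → ℕ) (sh : ShellSplit₁₃CoPH 2 0)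
    (hlev : ∀ (F : T4Family) (θ : Stage13HParams F 2) (hP : θ.Provisos₁₃CoPH F 2), (θ.ZhUnity F 2 ∧ θ.SlotsNondegenerate₁₃ F 2) → θ.Admissible F 2 →
      ∀ (g₀ : ℕ → ℝ) (os : List (ULoop F)), letI := Classical.decEq (Σ K, SiteSeqKey F (0 + K))
      ∃ a b : ℕ → ℕ → ℝ, (∀ K, ∀ j < jc F θ hP g₀ os K, 0 ≤ a j K) ∧
        (∀ (K : ℕ) (t : ℝ), |t| ≤ 1 → ∀ j < jc F θ hP g₀ os K,
          ∑ x ∈ badClass₁₃ θ 0 g₀ (fun _ => j + 1) K t \ badClass₁₃ θ 0 g₀ (fun _ => j) K t, weightA₁₃ θ hP 0 g₀ os K t x ≤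
            a j K * ∑ x ∈ classSet₁₃ θ 0 g₀ K, weightA₁₃ θ hP 0 g₀ os K t x) ∧
        (∀ (K : ℕ) (t : ℝ), |t| ≤ 1 → ∀ j < jc F θ hP g₀ os K,
          ∑ x ∈ badClass₁₃ θ 0 g₀ (fun _ => j + 1) K t \ badClass₁₃ θ 0 g₀ (fun _ => j) K t, weightB₁₃ θ hP 0 g₀ os K t x ≤
            b j K * ∑ x ∈ classSet₁₃ θ 0 g₀ K, weightB₁₃ θ hP 0 g₀ os K t x) ∧
        (∀ K, ∑ j ∈ Finset.range (jc F θ hP g₀ os K), max (a j K) (b j K) < 1) ∧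
        Summable fun K => ∑ j ∈ Finset.range (jc F θ hP g₀ os K), max (a j K) (b j K)) :
    ∀ (F : T4Family) (θ : Stage13HParams F 2) (hP : θ.Provisos₁₃CoPH F 2), (θ.ZhUnity F 2 ∧ θ.SlotsNondegenerate₁₃ F 2) → θ.Admissible F 2 →
      ∀ (g₀ : ℕ → ℝ) (os : List (ULoop F)),
        RelWeightBound (crOfRecord₁₃VAt 0 (jc F θ hP g₀ os) sh F θ hP g₀ os).l₀ (crOfRecord₁₃VAt 0 (jc F θ hP g₀ os) sh F θ hP g₀ os).T
          (crOfRecord₁₃VAt 0 (jc F θ hP g₀ os) sh F θ hP g₀ os).A (crOfRecord₁₃VAt 0 (jc F θ hP g₀ os) sh F θ hP g₀ os).B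
          (crOfRecord₁₃VAt 0 (jc F θ hP g₀ os) sh F θ hP g₀ os).Bad (crOfRecord₁₃VAt 0 (jc F θ hP g₀ os) sh F θ hP g₀ os).W := by
  intro F θ hP hG hθ g₀ os
  letI := Classical.decEq (Σ K, SiteSeqKey F (0 + K))
  obtain ⟨a, b, ha, hA, hB, hlt, hsum⟩ := hlev F θ hP hG hθ g₀ os
  exact relWeightBound_crOfRecord₁₃VAt_of_levelFractions θ hP 0 g₀ os (jc F θ hP g₀ os) sh ha hA hB hlt hsum

end ShapeLevels

/-! ## §3  Run B's keys in the strata, single-level form (the complement of CLAIM-1 §2 `keyA₁₃_mem_stratum_iff`: run B reads its first large field ONE LEVEL UP) -/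

section RunB

variable {F : T4Family} {N : ℕ} [NeZero N] (θ : Stage13HParams F N) (K₀ : ℕ) (g₀ : ℕ → ℝ) [DecidableEq (Σ K, SiteSeqKey F (K₀ + K))]

/-- **RUN B's KEY IN THE STRATUM `j`, SINGLE-LEVEL FORM** (`0 < θ.τ9.M`, `j + 1 ≤ K₀ + K`; gen 0's exact block-down reading `keyOldLargeField_twoRunKeyB_iff_last`): the (2.18)
history `s'` of run B (cutoff `K₀+K+1`) has its σ-key in the stratum `j` of the keys of record iff `s'.Λ_{j+2} ≠ T_η` and (for `j ≥ 1`) `s'.Λ_{j+1} = T_η` — its first large-field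
region is created ONE LEVEL UP from run A's reading of the same stratum (the direction a weight bound on the bad fibre consumes, `Node00/TwoRunSitePersistence` §2).
[cite: Balaban1988Convergent, (2.1) p.254, (2.18) p.257; Balaban1989LargeFieldII, (1.80) p.384 (bookkeeping)] -/
theorem keyB₁₃_mem_stratum_iff (hM : 0 < θ.τ9.M) (K : ℕ) (t : ℝ) {j : ℕ} (hj : j + 1 ≤ K₀ + K)
    (s' : SeqOfRecord F θ.ν θ.τ9.M (histB₁₃ θ K₀ g₀ K) (K₀ + K + 1) (K₀ + K + 1)) :
    keyB₁₃ θ K₀ g₀ K s' ∈ badClass₁₃ θ K₀ g₀ (fun _ => j + 1) K t \ badClass₁₃ θ K₀ g₀ (fun _ => j) K t ↔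
      s'.Λ (j + 2) ≠ Set.univ ∧ (1 ≤ j → s'.Λ (j + 1) = Set.univ) := by
  rw [Finset.mem_sdiff, keyB₁₃_mem_badClass₁₃_iff, keyB₁₃_mem_badClass₁₃_iff, keyB₁₃_eq θ K₀ g₀ hM K s']
  have hB : ∀ {n : ℕ}, 1 ≤ n → n ≤ K₀ + K →
      (KeyOldLargeField n (twoRunKeyB F θ.ν hM (histB₁₃ θ K₀ g₀ K) (K₀ + K) (K₀ + K) s') ↔ s'.Λ (n + 1) ≠ Set.univ) := fun h1 hn =>
    keyOldLargeField_twoRunKeyB_iff_last F θ.ν hM (histB₁₃ θ K₀ g₀ K) (K₀ + K) (K₀ + K) h1 hn s'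
  show KeyOldLargeField (j + 1) (twoRunKeyB F θ.ν hM (histB₁₃ θ K₀ g₀ K) (K₀ + K) (K₀ + K) s') ∧
      ¬ KeyOldLargeField j (twoRunKeyB F θ.ν hM (histB₁₃ θ K₀ g₀ K) (K₀ + K) (K₀ + K) s') ↔ _
  rw [hB (by omega) hj]
  rcases Nat.eq_zero_or_pos j with rfl | hj1
  · constructor
    · rintro ⟨h, -⟩
      exact ⟨h, fun h0 => absurd h0 (by omega)⟩
    · rintro ⟨h, -⟩
      exact ⟨h, not_keyOldLargeField_zero _⟩
  · rw [hB hj1 (by omega)]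
    constructor
    · rintro ⟨h, hn⟩
      exact ⟨h, fun _ => not_not.1 hn⟩
    · rintro ⟨h, hall⟩
      exact ⟨h, not_not.2 (hall hj1)⟩

end RunB

/-! ## §4  The design rule: a minimal age `a₀` with `V·r^{a₀} < 1 − r` and a linear age floor suffice (the per-step threshold of CLAIM-1 §4 discharged once and for all) -/

section DesignRule

variable {F : T4Family} {N : ℕ} [NeZero N] (θ : Stage13HParams F N) (hP : θ.Provisos₁₃CoPH F N) (K₀ : ℕ) (g₀ : ℕ → ℝ) (os : List (ULoop F))
  (jcut : ℕ → ℕ) (sh : ShellSplit₁₃CoPH N K₀) [DecidableEq (Σ K, SiteSeqKey F (K₀ + K))]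

/-- **THE AGE-FLOOR THRESHOLD**: if `V·r^{a₀} < 1 − r` and the policy's age floor is at least `a₀` at step `K` (`a₀ ≤ K₀ + K − jcut K`), then the survival majorant of CLAIM-1 §4 is
below `1` at that step: `V·r^{K₀+K−jcut K}∕(1−r) < 1` (`0 ≤ r < 1`, `0 ≤ V`). [cite: Balaban1989LargeFieldII, (1.80) p.384; King1986, (3.10)–(3.11) p.656 (bookkeeping)] -/
theorem survivalMajorant_lt_one_of_ageFloor {r V : ℝ} {a₀ : ℕ} (h0 : 0 ≤ r) (h1 : r < 1) (hV : 0 ≤ V) (hthr : V * r ^ a₀ < 1 - r) (K : ℕ)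
    (hfloor : a₀ ≤ K₀ + K - jcut K) : V * r ^ (K₀ + K - jcut K) / (1 - r) < 1 := by
  rw [div_lt_one (sub_pos.2 h1)]
  exact (mul_le_mul_of_nonneg_left (pow_le_pow_of_le_one h0 h1.le hfloor) hV).trans_lt hthr

/-- **★★ N20 AT THE READING OF RECORD — THE DESIGN RULE**: a per-birth-level survival rate `0 < r < 1` with entropy letter `V ≥ 0` at the keyed classes of record (the domination of
CLAIM-1 §4 against the class totals, both runs), a MINIMAL AGE `a₀` with `V·r^{a₀} < 1 − r`, and a cut reading inside the window whose age floor is at least `a₀` at every step and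
grows linearly (`c·K ≤ K₀ + K − jcut K`, `c > 0`) ⇒ `RelWeightBound` AT `crOfRecord₁₃VAt K₀ jcut sh F θ hP g₀ os` with its canonical `W`.  So on the N20 face the policy question is
settled by TWO numbers read off the survival data: the minimal age `a₀ > log_{1∕r}(V∕(1−r))` and any positive slope `c`; the survival domination itself is NE7b's body — NAMED OPEN.
[cite: Balaban1989LargeFieldII, Thm 1 + (0.1) pp.355–356, (1.80) p.384, (1.89) p.387; Balaban1989LargeFieldI, p.177 (i)–(ii); King1986, (3.10)–(3.11) p.656 (bookkeeping)] -/
theorem relWeightBound_crOfRecord₁₃VAt_of_survival_ageFloor {r V c : ℝ} {a₀ : ℕ} (h0 : 0 < r) (h1 : r < 1) (hV : 0 ≤ V) (hc : 0 < c)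
    (hthr : V * r ^ a₀ < 1 - r) (hwin : ∀ K, jcut K ≤ K₀ + K) (hfloor : ∀ K, a₀ ≤ K₀ + K - jcut K)
    (hfrac : ∀ K : ℕ, c * K ≤ ((K₀ + K - jcut K : ℕ) : ℝ))
    (hA : ∀ (K : ℕ) (t : ℝ), |t| ≤ 1 → ∀ j < jcut K,
      ∑ x ∈ badClass₁₃ θ K₀ g₀ (fun _ => j + 1) K t \ badClass₁₃ θ K₀ g₀ (fun _ => j) K t, weightA₁₃ θ hP K₀ g₀ os K t x ≤
        V * r ^ (K₀ + K - (j + 1)) * ∑ x ∈ classSet₁₃ θ K₀ g₀ K, weightA₁₃ θ hP K₀ g₀ os K t x)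
    (hB : ∀ (K : ℕ) (t : ℝ), |t| ≤ 1 → ∀ j < jcut K,
      ∑ x ∈ badClass₁₃ θ K₀ g₀ (fun _ => j + 1) K t \ badClass₁₃ θ K₀ g₀ (fun _ => j) K t, weightB₁₃ θ hP K₀ g₀ os K t x ≤
        V * r ^ (K₀ + K - (j + 1)) * ∑ x ∈ classSet₁₃ θ K₀ g₀ K, weightB₁₃ θ hP K₀ g₀ os K t x) :
    RelWeightBound (crOfRecord₁₃VAt K₀ jcut sh F θ hP g₀ os).l₀ (crOfRecord₁₃VAt K₀ jcut sh F θ hP g₀ os).T (crOfRecord₁₃VAt K₀ jcut sh F θ hP g₀ os).A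
      (crOfRecord₁₃VAt K₀ jcut sh F θ hP g₀ os).B (crOfRecord₁₃VAt K₀ jcut sh F θ hP g₀ os).Bad (crOfRecord₁₃VAt K₀ jcut sh F θ hP g₀ os).W :=
  relWeightBound_crOfRecord₁₃VAt_of_survival_linearAge θ hP K₀ g₀ os jcut sh h0 h1 hV hc hwin hfrac hA hB
    fun K => survivalMajorant_lt_one_of_ageFloor K₀ jcut h0.le h1 hV hthr K (hfloor K)

end DesignRule

/-! ## §5  (v1.1, APPEND-ONLY) HONESTY AT THE FULL KEY: the survival letter and the census's first-level saturation are compatible only along eventually-zero cuts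
(the policy wall of dag-n20-w1 `…PolicyWall` p597932 read DIRECTLY on CLAIM-1 §4's hypothesis — no summability, no threshold: at a cutting step the stratum-0 survival
factor `V·r^{K₀+K−1}` must dominate the level-one fraction, and it tends to `0`) -/

section FullKeyHonesty

open _root_.Filter _root_.Topology

variable {F : T4Family} {N : ℕ} [NeZero N] (θ : Stage13HParams F N) (hP : θ.Provisos₁₃CoPH F N) (K₀ : ℕ) (g₀ : ℕ → ℝ) (os : List (ULoop F))
  [DecidableEq (Σ K, SiteSeqKey F (K₀ + K))]

/-- **THE STRATUM `0` IS THE LEVEL-ONE CLASS** (the level-`0` class is empty, CLAIM-1 `badClass₁₃_level_zero`). [cite: Balaban1989LargeFieldII, (1.80) p.384 (bookkeeping)] -/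
theorem stratum_zero_eq_levelOne (K : ℕ) (t : ℝ) :
    badClass₁₃ θ K₀ g₀ (fun _ => 0 + 1) K t \ badClass₁₃ θ K₀ g₀ (fun _ => 0) K t = badClass₁₃ θ K₀ g₀ (fun _ => 1) K t := by
  rw [N20KeyedRelWeightLevels.badClass₁₃_level_zero θ K₀ g₀ K t, Finset.sdiff_empty]

/-- **AT A CUTTING STEP THE SURVIVAL LETTER DOMINATES THE LEVEL-ONE FRACTION**: if at step `K` the stratum-`0` mass of run A is `≤ V·r^{K₀+K−1} ·` (run A's class total)
(CLAIM-1 §4's hypothesis at `j = 0`, available when `1 ≤ jcut K`) and at a source `|t| ≤ 1` with positive total the LEVEL-ONE class holds the fraction `κ`, then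
`κ ≤ V·r^{K₀+K−1}`. [cite: Balaban1989LargeFieldII, (1.80) p.384; King1986, (3.10)–(3.11) p.656 (bookkeeping)] -/
theorem levelOne_fraction_le_survival {r V κ : ℝ} (K : ℕ) {t : ℝ}
    (hA0 : ∑ x ∈ badClass₁₃ θ K₀ g₀ (fun _ => 0 + 1) K t \ badClass₁₃ θ K₀ g₀ (fun _ => 0) K t, weightA₁₃ θ hP K₀ g₀ os K t x ≤
      V * r ^ (K₀ + K - (0 + 1)) * ∑ x ∈ classSet₁₃ θ K₀ g₀ K, weightA₁₃ θ hP K₀ g₀ os K t x)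
    (hpos : 0 < ∑ x ∈ classSet₁₃ θ K₀ g₀ K, weightA₁₃ θ hP K₀ g₀ os K t x)
    (hκ : κ * ∑ x ∈ classSet₁₃ θ K₀ g₀ K, weightA₁₃ θ hP K₀ g₀ os K t x ≤ ∑ x ∈ badClass₁₃ θ K₀ g₀ (fun _ => 1) K t, weightA₁₃ θ hP K₀ g₀ os K t x) :
    κ ≤ V * r ^ (K₀ + K - 1) := by
  rw [stratum_zero_eq_levelOne θ K₀ g₀ K t] at hA0
  exact le_of_mul_le_mul_right (hκ.trans hA0) hpos

/-- **★★ AT THE FULL KEY THE SURVIVAL LETTER AND FIRST-LEVEL SATURATION MEET ONLY ALONG EVENTUALLY-ZERO CUTS.**  If the per-birth-level survival domination of CLAIM-1 §4 holds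
for run A at every step (rate `0 ≤ r < 1`, entropy `V ≥ 0`, the cut reading `jcut`), and from some step on the LEVEL-ONE class of record holds the fraction `κ > 0` of run A's mass at
some admissible source with positive total (the census's saturation letter of dag-n20-w1 p597932, DISPLAYED), then `∀ᶠ K, jcut K = 0`: the stratum-`0` factor `V·r^{K₀+K−1} → 0`
falls below `κ` and no later step can cut a level.  So at the pinned FULL-history key the hypothesis of `relWeightBound_crOfRecord₁₃VAt_of_survival` is INHABITABLE ONLY TOGETHER WITH an
eventually-zero cut (where the face is free) — the policy wall read on the survival currency, with no summability or threshold clause; its non-vacuous home would be a region-relative key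
(crux card `window-key-core`, untyped).  HONEST: located bookkeeping, nothing of Bałaban's asserted.
[cite: Balaban1989LargeFieldII, (1.80) p.384, (1.89) p.387; Balaban1988Convergent, (2.18) p.257, p.244; King1986, (3.10)–(3.11) p.656 (bookkeeping)] -/
theorem eventually_cut_eq_zero_of_survival_of_saturated {r V κ : ℝ} (h0 : 0 ≤ r) (h1 : r < 1) (hκ0 : 0 < κ) (jcut : ℕ → ℕ)
    (hA : ∀ (K : ℕ) (t : ℝ), |t| ≤ 1 → ∀ j < jcut K,
      ∑ x ∈ badClass₁₃ θ K₀ g₀ (fun _ => j + 1) K t \ badClass₁₃ θ K₀ g₀ (fun _ => j) K t, weightA₁₃ θ hP K₀ g₀ os K t x ≤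
        V * r ^ (K₀ + K - (j + 1)) * ∑ x ∈ classSet₁₃ θ K₀ g₀ K, weightA₁₃ θ hP K₀ g₀ os K t x)
    (hsat : ∀ᶠ K in atTop, ∃ t : ℝ, |t| ≤ 1 ∧ 0 < ∑ x ∈ classSet₁₃ θ K₀ g₀ K, weightA₁₃ θ hP K₀ g₀ os K t x ∧
      κ * ∑ x ∈ classSet₁₃ θ K₀ g₀ K, weightA₁₃ θ hP K₀ g₀ os K t x ≤ ∑ x ∈ badClass₁₃ θ K₀ g₀ (fun _ => 1) K t, weightA₁₃ θ hP K₀ g₀ os K t x) :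
    ∀ᶠ K in atTop, jcut K = 0 := by
  have hage : Tendsto (fun K : ℕ => K₀ + K - 1) atTop atTop := tendsto_atTop_atTop.2 fun b => ⟨b + 1, fun K hK => by omega⟩
  have hlim : Tendsto (fun K : ℕ => V * r ^ (K₀ + K - 1)) atTop (𝓝 0) := by
    simpa using ((tendsto_pow_atTop_nhds_zero_of_lt_one h0 h1).comp hage).const_mul V
  filter_upwards [hsat, hlim.eventually (gt_mem_nhds hκ0)] with K hK hlt
  obtain ⟨t, ht, hpos, hle⟩ := hK
  by_contra hne
  have hcut : 0 < jcut K := Nat.pos_of_ne_zero hne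
  exact (lt_irrefl κ) ((levelOne_fraction_le_survival θ hP K₀ g₀ os K (hA K t ht 0 hcut) hpos hle).trans_lt hlt)

end FullKeyHonesty

end Summit.QuantumFields.YangMills.BalabanUVNodes.N20KeyedRelWeightLevelsLive

end
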